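import Summits.BirchSwinnertonDyer.Rank1Residual.Additive.KobayashiSignedGenerationOfStab
import Summits.BirchSwinnertonDyer.Rank1Residual.Additive.CyclotomicTowerLocalStab
import Summits.BirchSwinnertonDyer.Rank1Residual.Additive.CyclotomicTowerSignedLocalTransverseH1Padic
import Summits.BirchSwinnertonDyer.Rank1Residual.Additive.GoodSupersingularPadicModel
import HarnessLib

/-!
# `hsum` UNCONDITIONAL for cc-typer-6's tower `K₀·K_n^κ` (Kobayashi Prop. 8.12 ii), generation half):
# `E(K_{n,v}) = E⁺(K_{n,v}) + E⁻(K_{n,v})` for `κ` cyclotomic, `K₀ ⊇ μ_p` of degree `≤ p − 1`, `p` odd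
# and a good supersingular curve with `a_p = 0`; hence the point- and class-level transversality (T)
# of the local (C3_η) chain with NO local hypothesis left (cell `b2b-bsdres`, CLASS-CLOSURE lane,
# class O10 — x1b GEN 34, class lead; file 40 of the local series: assembly of files 36–39)

HONEST FRAMING (cell `b2b-bsdres`, run/shared/lean/b2b/bsd-rank1-residual/, verbatim in every
file): the goal of the cell is to DELETE the COMBINATION-SHAPED residual classes of the
Birch–Swinnerton-Dyer formula for ALL analytic-rank `≤ 1` elliptic curves over `ℚ` — "full BSD
formula for every rank `≤ 1` curve in class `C`" assembled STRICTLY from published theorems — so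
that the rank-`≤ 1` remainder becomes exactly the CONSTRUCTION-SHAPED classes, which are TYPED
(missing-input `Prop`s), NOT attempted. This is not "finishing BSD". CLASS-CLOSURE lane: prove
what is provable now; shrink each hard class to its core with data; no claim beyond stated classes;
research routes on CONSTRUCTION-SHAPED X12 / O10; census / instrument output = EVIDENCE / conjecture
items, NEVER a Literature fact; `RESIDUAL-MAP.md` marks change only by signed lines. THIS FILE:
TOOL THEOREMS ONLY — no definition, no named Literature fact, no Summits-side fact `def … : Prop`,
no `sorry`, axioms standard; nothing is booked; no label / mark / count / sub-cell moves; (C1_η),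
(C2_η-GZ), (C3_η) stay typed as filed; O10 stays OPEN / CONSTRUCTION-SHAPED; nothing about `BSD(W, p)`
of any pair is claimed.

## Content (`K` a number field with `K → ℚ_p`, `κ : ZpExtension K p` cyclotomic, `K₀/K` a number
## field with a primitive `p`-th root of unity and `[Γ_K : Gal(K̄/K₀)] ≤ p − 1`, `Gal(K̄/K₀) ⊴ Γ_K`,
## `ι : K̄ → ℚ̄_p`, `W/K` elliptic; Kobayashi: `K = ℚ`, `K₀ = ℚ(μ_p)`, `K₀·K_n^κ = ℚ(ζ_{p^{n+1}})`)

* §1 The good supersingular `ℤ_p`-model of a globally minimal `V/ℚ` with `a_p(V) = 0` in the binders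
  of the Honda/Kobayashi files (`M ⊗ ℚ_p`, `M mod p` elliptic, `tr(M mod p) = 0`, `M ⊗ ℚ̄_p = V ⊗ ℚ̄_p`).
* §2 **`localFixedPointsOfEmb_towerSubgroup_le_sup_towerSigned`**: `E(K_{n,v}) ≤ E⁺(K_{n,v}) ⊔ E⁻(K_{n,v})`
  for EVERY `n` (files 38 + 39: `hU` = `localSubgroupOfEmb_towerSubgroup_eq_stab`), and the equality;
  `_of_goodSupersingular` (no model hypothesis).
* §3 **Transversality (T) with NO local hypothesis**: point level
  (`exists_eq_nsmul_of_pow_nsmul_eq_add_towerSubgroup`) and class level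
  (`not_mem_localKummerOverOfEmb_neg_one_of_kummer_generator_towerSubgroup`) — gen 32's `…_padic`
  theorems with their `hsum` hypothesis discharged; `_of_goodSupersingular` forms.

NET LOCAL STATUS after this file: for cc-typer-6's tower at `E = ℚ_p` and a globally minimal good
supersingular `V/ℚ` with `a_p = 0`, `p` odd, `K₀ ⊇ μ_p` Galois of degree `≤ p − 1`, `κ` cyclotomic:
Prop. 8.7 (every layer and `K_∞`), Prop. 8.12 ii) BOTH identities, the local layer indices, and the
transversality (T) of the η-odd Kummer line are ALL kernel theorems — the local side of the (C3_η)
derivation carries no hypothesis. NOT here: the GLOBAL count (C) (corank / Poitou–Tate), (C1_η),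
(C2_η-GZ).

References: [Kobayashi2003] §2 p. 4, Prop. 8.7 (p. 16), Prop. 8.11, Prop. 8.12 ii) (pp. 17–18),
Def. 8.16 / Lemma 8.17 (p. 19), §8.4; [SilvermanAEC2009] V.4.1(a), VII.2.1, VII.5.1(a);
[SerreInventiones1972] §1.11 Prop. 12.
-/

noncomputable section

open scoped Classical

namespace Summit.BirchSwinnertonDyer.Rank1Residual.Additive

open Literature.NumberTheory.EllipticCurves Literature.NumberTheory.GaloisRepresentations
  Literature.NumberTheory.EllipticCurves.Kobayashi2003 ZpExtension WeierstrassCurve PadicCyclotomicTower BallEval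

variable {p : ℕ} [hp : Fact p.Prime]

/-! ## §1 The good supersingular `ℤ_p`-model in the Honda–Kobayashi binders -/

/-- **The `ℤ_p`-model of a globally minimal `V/ℚ` with good reduction at `p` and `a_p(V) = 0`**, in the
binders of the Honda/Kobayashi files: `M = integralModelInt V ⊗ ℤ_p` has `M ⊗ ℚ_p` elliptic,
`M mod p` elliptic (`p ∤ Δ_min`, Silverman VII.5.1(a)), `tr(M mod p) = a_p(V) = 0`, and
`M ⊗ ℚ̄_p = V ⊗ ℚ̄_p`. [cite: SilvermanAEC2009, VII.5 Prop. 5.1(a)] -/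
theorem exists_padicModel_tr_eq_zero (V : WeierstrassCurve ℚ) [V.IsElliptic] [V.IsGloballyMinimal]
    (hgood : V.HasGoodReductionAtPrime p) (hap : V.frobeniusTrace p = 0) :
    ∃ M : WeierstrassCurve ℤ_[p], (M.map PadicInt.Coe.ringHom).IsElliptic ∧ (M.map PadicInt.toZMod).IsElliptic ∧
      Literature.NumberTheory.EllipticCurves.HasseManin.tr (M.map PadicInt.toZMod) = 0 ∧
      M.baseChange (AlgebraicClosure ℚ_[p]) = V.baseChange (AlgebraicClosure ℚ_[p]) := by
  have hΔ : ¬ (p : ℤ) ∣ minimalDiscriminantInt V :=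
    not_dvd_minimalDiscriminantInt_of_hasGoodReductionAtPrime' V p hgood
  set M : WeierstrassCurve ℤ_[p] := (integralModelInt V).map (Int.castRingHom ℤ_[p]) with hM
  have hmodp : M.map PadicInt.toZMod = (integralModelInt V).map (Int.castRingHom (ZMod p)) := by
    rw [hM, WeierstrassCurve.map_map]
    exact congrArg (fun φ : ℤ →+* ZMod p => (integralModelInt V).map φ) (RingHom.ext_int _ _)
  have hgen : M.map PadicInt.Coe.ringHom = (integralModelInt V).map (Int.castRingHom ℚ_[p]) := by
    rw [hM, WeierstrassCurve.map_map]
    exact congrArg (fun φ : ℤ →+* ℚ_[p] => (integralModelInt V).map φ) (RingHom.ext_int _ _)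
  refine ⟨M, ?_, ?_, ?_, ?_⟩
  · rw [hgen]
    refine ⟨isUnit_iff_ne_zero.mpr ?_⟩
    rw [map_Δ, eq_intCast]
    change ((minimalDiscriminantInt V : ℤ) : ℚ_[p]) ≠ 0
    exact_mod_cast minimalDiscriminantInt_ne_zero V
  · rw [hmodp]
    refine ⟨isUnit_iff_ne_zero.mpr ?_⟩
    rw [map_Δ, eq_intCast]
    change ((minimalDiscriminantInt V : ℤ) : ZMod p) ≠ 0
    rwa [Ne, ZMod.intCast_zmod_eq_zero_iff_dvd]
  · rw [hmodp]
    change ((Fintype.card (ZMod p) : ℤ) + 1 - Nat.card ((integralModelInt V).map (Int.castRingHom (ZMod p))).toAffine.Point : ℤ) = 0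
    rw [ZMod.card]
    exact hap
  · conv_rhs => rw [← map_integralModelInt V]
    rw [hM, WeierstrassCurve.baseChange, WeierstrassCurve.baseChange, WeierstrassCurve.map_map,
      WeierstrassCurve.map_map]
    congr 1

/-- `[K₀ : K] ≤ p − 1 ⟹ [K₀ : K] < (p² − 1)/2` for `p` odd (the degree bound of gen 32's Prop. 8.7
files from the one of F9). [folklore] -/
theorem lt_half_sq_sub_one_of_le_sub_one (hp2 : p ≠ 2) {d : ℕ} (hd : d ≤ p - 1) : d < (p ^ 2 - 1) / 2 := by
  have h3 : 3 ≤ p := by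
    rcases hp.out.eq_two_or_odd' with h | h
    · exact absurd h hp2
    · have := hp.out.two_le; rcases h with ⟨k, hk⟩; omega
  have h9 : 3 * p ≤ p ^ 2 := by rw [sq]; exact Nat.mul_le_mul_right p h3
  omega

section Tower

variable {K : Type} [Field K] [NumberField K] [Algebra K ℚ_[p]] (κ : ZpExtension K p)
  (K₀ : Type) [Field K₀] [NumberField K₀] [Algebra K K₀] [(galRange (K := K) K₀).Normal]
  (ι : AlgebraicClosure K →ₐ[K] AlgebraicClosure ℚ_[p]) (W : WeierstrassCurve K) [W.IsElliptic]

variable {κ}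

/-! ## §2 Prop. 8.12 ii) (generation half) for cc-typer-6's tower, NO hypothesis -/

/-- **`hsum` UNCONDITIONAL — Kobayashi Prop. 8.12 ii), generation half, for the tower `K₀·K_n^κ`.**
For `κ` cyclotomic, `K₀ ⊇ μ_p` with `[Γ_K : Gal(K̄/K₀)] ≤ p − 1`, `p` odd, `W/K` elliptic with a
`ℤ_p`-model `M` (`M ⊗ ℚ̄_p = W ⊗ ℚ̄_p`, `M mod p` elliptic, `a_p(M) = 0`): for every `n`,
`E(K_{n,v}) ≤ E⁺(K_{n,v}) ⊔ E⁻(K_{n,v})` (`localFixedPointsOfEmb_le_sup_towerSigned_of_stab` with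
`hU = localSubgroupOfEmb_towerSubgroup_eq_stab`). [cite: Kobayashi2003, Prop. 8.12] -/
theorem localFixedPointsOfEmb_towerSubgroup_le_sup_towerSigned (hp2 : p ≠ 2) (hκ : κ.IsCyclotomic)
    (hz : ∃ z : K₀, IsPrimitiveRoot z p) (hidx : (galRange (K := K) K₀).index ≤ p - 1)
    (M : WeierstrassCurve ℤ_[p]) [(M.map PadicInt.Coe.ringHom).IsElliptic] [(M.map PadicInt.toZMod).IsElliptic]
    (htr : Literature.NumberTheory.EllipticCurves.HasseManin.tr (M.map PadicInt.toZMod) = 0)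
    (hWM : M.baseChange (AlgebraicClosure ℚ_[p]) = W.baseChange (AlgebraicClosure ℚ_[p])) (n : ℕ) :
    localFixedPointsOfEmb ι W (towerSubgroup κ K₀ n) ≤
      towerSignedLocalPointsOfEmb (towerSubgroup κ K₀) ι W 1 n ⊔
        towerSignedLocalPointsOfEmb (towerSubgroup κ K₀) ι W (-1) n :=
  localFixedPointsOfEmb_le_sup_towerSigned_of_stab hp2 htr (towerSubgroup_antitone κ K₀)
    (localSubgroupOfEmb_towerSubgroup_eq_stab K₀ ι hp2 hκ hz hidx) hWM n

/-- **Prop. 8.12 ii), second identity, as an EQUALITY**: `E⁺(K_{n,v}) ⊔ E⁻(K_{n,v}) = E(K_{n,v})`.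
[cite: Kobayashi2003, Prop. 8.12] -/
theorem sup_towerSigned_towerSubgroup_eq (hp2 : p ≠ 2) (hκ : κ.IsCyclotomic)
    (hz : ∃ z : K₀, IsPrimitiveRoot z p) (hidx : (galRange (K := K) K₀).index ≤ p - 1)
    (M : WeierstrassCurve ℤ_[p]) [(M.map PadicInt.Coe.ringHom).IsElliptic] [(M.map PadicInt.toZMod).IsElliptic]
    (htr : Literature.NumberTheory.EllipticCurves.HasseManin.tr (M.map PadicInt.toZMod) = 0)
    (hWM : M.baseChange (AlgebraicClosure ℚ_[p]) = W.baseChange (AlgebraicClosure ℚ_[p])) (n : ℕ) :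
    towerSignedLocalPointsOfEmb (towerSubgroup κ K₀) ι W 1 n ⊔
        towerSignedLocalPointsOfEmb (towerSubgroup κ K₀) ι W (-1) n =
      localFixedPointsOfEmb ι W (towerSubgroup κ K₀ n) :=
  sup_towerSigned_eq_localFixedPointsOfEmb_of_stab hp2 htr (towerSubgroup_antitone κ K₀)
    (localSubgroupOfEmb_towerSubgroup_eq_stab K₀ ι hp2 hκ hz hidx) hWM n

/-- **`hsum` for a globally minimal good supersingular `V/ℚ` with `a_p(V) = 0` read over `K`** (no
model hypothesis; `K₀/K` Galois of degree `≤ p − 1` with a primitive `p`-th root of unity).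
[cite: Kobayashi2003, Prop. 8.12] -/
theorem localFixedPointsOfEmb_towerSubgroup_le_sup_towerSigned_of_goodSupersingular [IsGalois K K₀]
    (hp2 : p ≠ 2) (hκ : κ.IsCyclotomic) (hz : ∃ z : K₀, IsPrimitiveRoot z p) (hK₀ : Module.finrank K K₀ ≤ p - 1)
    (V : WeierstrassCurve ℚ) [V.IsElliptic] [V.IsGloballyMinimal]
    (hgood : V.HasGoodReductionAtPrime p) (hap : V.frobeniusTrace p = 0)
    (hWV : W.baseChange (AlgebraicClosure ℚ_[p]) = V.baseChange (AlgebraicClosure ℚ_[p])) (n : ℕ) :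
    localFixedPointsOfEmb ι W (towerSubgroup κ K₀ n) ≤
      towerSignedLocalPointsOfEmb (towerSubgroup κ K₀) ι W 1 n ⊔
        towerSignedLocalPointsOfEmb (towerSubgroup κ K₀) ι W (-1) n := by
  obtain ⟨M, hE, hEt, htr, hVM⟩ := exists_padicModel_tr_eq_zero V hgood hap
  haveI := hE; haveI := hEt
  exact localFixedPointsOfEmb_towerSubgroup_le_sup_towerSigned K₀ ι W hp2 hκ hz
    (by rw [RelModel.index_galRange (K := K) K₀]; exact hK₀) M htr (hVM.trans hWV.symm) n

/-! ## §3 Transversality (T) with NO local hypothesis -/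

/-- **Point-level transversality (T), UNCONDITIONAL**: an η-odd bottom point `P ∈ E(K_{0,v})`
(`τ • P = −P`) with `p^j • P = M' + p^{j+1} • Q`, `M' ∈ E⁻(K_{n,v})`, `Q ∈ E(K_{n,v})`, is
`p`-divisible in `E(K_{0,v})` — gen 32's `exists_eq_nsmul_of_pow_nsmul_eq_add_tower_padic` with its
`hsum` hypothesis DISCHARGED (§2). [cite: Kobayashi2003, Prop. 8.12 ii) (pp. 17–18), Lemma 8.17 (p. 19)] -/
theorem exists_eq_nsmul_of_pow_nsmul_eq_add_towerSubgroup (hp2 : p ≠ 2) (hκ : κ.IsCyclotomic)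
    (hz : ∃ z : K₀, IsPrimitiveRoot z p) (hidx : (galRange (K := K) K₀).index ≤ p - 1)
    (M : WeierstrassCurve ℤ_[p]) [(M.map PadicInt.Coe.ringHom).IsElliptic] [(M.map PadicInt.toZMod).IsElliptic]
    (htr : Literature.NumberTheory.EllipticCurves.HasseManin.tr (M.map PadicInt.toZMod) = 0)
    (hWM : M.baseChange (AlgebraicClosure ℚ_[p]) = W.baseChange (AlgebraicClosure ℚ_[p])) (n : ℕ)
    {P : localPoints W ℚ_[p]} (hP : P ∈ localFixedPointsOfEmb ι W (towerSubgroup κ K₀ 0))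
    {τ : Field.absoluteGaloisGroup ℚ_[p]} (hτ : τ • P = -P) (j : ℕ)
    {M' Q : localPoints W ℚ_[p]} (hM' : M' ∈ towerSignedLocalPointsOfEmb (towerSubgroup κ K₀) ι W (-1) n)
    (hQ : Q ∈ localFixedPointsOfEmb ι W (towerSubgroup κ K₀ n))
    (hPMQ : p ^ j • P = M' + p ^ (j + 1) • Q) :
    ∃ S ∈ localFixedPointsOfEmb ι W (towerSubgroup κ K₀ 0), P = p • S := by
  have hidx0 : (galRange (K := K) K₀).index ≠ 0 := Subgroup.FiniteIndex.index_ne_zero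
  exact exists_eq_nsmul_of_pow_nsmul_eq_add_tower_padic κ K₀ ι W hp2 M (isUnit_Δ_of_isElliptic_toZMod p M)
    (hasseCoeff_mem_maximalIdeal_of_tr_eq_zero hp2 M htr) hWM hidx0
    (lt_half_sq_sub_one_of_le_sub_one hp2 hidx) n
    (localFixedPointsOfEmb_towerSubgroup_le_sup_towerSigned K₀ ι W hp2 hκ hz hidx M htr hWM n) hP hτ j hM' hQ hPMQ

/-- **Class-level transversality (T), UNCONDITIONAL**: for `g ∈ E(K_{0,v})` η-odd and not
`p`-divisible there, no class of `H¹(Gal(K̄/K₀K_n), E[p^∞])` restricting at `ι` to the Kummer class of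
`g ⊗ p^{−1}` lies in the Kummer condition cut out by `E⁻(K_{n,v})` — gen 32's
`not_mem_localKummerOverOfEmb_neg_one_of_kummer_generator_towerSubgroup_padic` with `hsum`
DISCHARGED. This is the local constant `u(p) = 0` of the (C3_η) anatomy, now hypothesis-free.
[cite: Kobayashi2003, Def. 2.1 (p. 5), Prop. 8.12 ii) (pp. 17–18), Prop. 8.7 (p. 16)] -/
theorem not_mem_localKummerOverOfEmb_neg_one_of_kummer_generator_towerSubgroup (hp2 : p ≠ 2)
    (hκ : κ.IsCyclotomic) (hz : ∃ z : K₀, IsPrimitiveRoot z p) (hidx : (galRange (K := K) K₀).index ≤ p - 1)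
    (M : WeierstrassCurve ℤ_[p]) [(M.map PadicInt.Coe.ringHom).IsElliptic] [(M.map PadicInt.toZMod).IsElliptic]
    (htr : Literature.NumberTheory.EllipticCurves.HasseManin.tr (M.map PadicInt.toZMod) = 0)
    (hWM : M.baseChange (AlgebraicClosure ℚ_[p]) = W.baseChange (AlgebraicClosure ℚ_[p])) (n : ℕ)
    {g : localPoints W ℚ_[p]} (hg : g ∈ localFixedPointsOfEmb ι W (towerSubgroup κ K₀ 0))
    {τ₀ : Field.absoluteGaloisGroup ℚ_[p]} (hτ₀ : τ₀ • g = -g)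
    (hndiv : ∀ S ∈ localFixedPointsOfEmb ι W (towerSubgroup κ K₀ 0), g ≠ p • S)
    {c : W.subgroupH1 p (towerSubgroup κ K₀ n)}
    (hcg : ∃ (ψ : contOneCocycles (discreteTopRep (towerSubgroup κ K₀ n) (W.geomPrimaryTorsion p)))
      (Q₁ : localPoints W ℚ_[p]) (j : ℕ),
      oneCocycleClass (discreteTopRep (towerSubgroup κ K₀ n) (W.geomPrimaryTorsion p)) ψ = c ∧
        p ^ (j + 1) • Q₁ = p ^ j • g ∧
        ∀ τ : localSubgroupOfEmb (towerSubgroup κ K₀ n) ι,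
          pointsMapOfEmb W ι ((ψ.1 (resGalSubgroupOfEmb (towerSubgroup κ K₀ n) ι τ) :
              W.geomPrimaryTorsion p) : W.geomPoints) =
            (τ : Field.absoluteGaloisGroup ℚ_[p]) • Q₁ - Q₁) :
    c ∉ localKummerOverOfEmb W p (towerSubgroup κ K₀ n) ι
      (towerSignedLocalPointsOfEmb (towerSubgroup κ K₀) ι W (-1) n) := by
  have hidx0 : (galRange (K := K) K₀).index ≠ 0 := Subgroup.FiniteIndex.index_ne_zero
  exact not_mem_localKummerOverOfEmb_neg_one_of_kummer_generator_towerSubgroup_padic κ K₀ ι W hp2 M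
    (isUnit_Δ_of_isElliptic_toZMod p M) (hasseCoeff_mem_maximalIdeal_of_tr_eq_zero hp2 M htr) hWM hidx0
    (lt_half_sq_sub_one_of_le_sub_one hp2 hidx) n
    (localFixedPointsOfEmb_towerSubgroup_le_sup_towerSigned K₀ ι W hp2 hκ hz hidx M htr hWM n) hg hτ₀ hndiv hcg

/-- **Class-level transversality (T) for a globally minimal good supersingular `V/ℚ` with `a_p = 0`,
read over `K`, NO local and NO model hypothesis** (`K₀/K` Galois of degree `≤ p − 1` with a primitive
`p`-th root of unity, `κ` cyclotomic, `p` odd).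
[cite: Kobayashi2003, Def. 2.1 (p. 5), Prop. 8.12 ii) (pp. 17–18), Prop. 8.7 (p. 16)] -/
theorem not_mem_localKummerOverOfEmb_neg_one_of_kummer_generator_towerSubgroup_of_goodSupersingular'
    [IsGalois K K₀] (hp2 : p ≠ 2) (hκ : κ.IsCyclotomic) (hz : ∃ z : K₀, IsPrimitiveRoot z p)
    (hK₀ : Module.finrank K K₀ ≤ p - 1) (V : WeierstrassCurve ℚ) [V.IsElliptic] [V.IsGloballyMinimal]
    (hgood : V.HasGoodReductionAtPrime p) (hap : V.frobeniusTrace p = 0)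
    (hWV : W.baseChange (AlgebraicClosure ℚ_[p]) = V.baseChange (AlgebraicClosure ℚ_[p])) (n : ℕ)
    {g : localPoints W ℚ_[p]} (hg : g ∈ localFixedPointsOfEmb ι W (towerSubgroup κ K₀ 0))
    {τ₀ : Field.absoluteGaloisGroup ℚ_[p]} (hτ₀ : τ₀ • g = -g)
    (hndiv : ∀ S ∈ localFixedPointsOfEmb ι W (towerSubgroup κ K₀ 0), g ≠ p • S)
    {c : W.subgroupH1 p (towerSubgroup κ K₀ n)}
    (hcg : ∃ (ψ : contOneCocycles (discreteTopRep (towerSubgroup κ K₀ n) (W.geomPrimaryTorsion p)))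
      (Q₁ : localPoints W ℚ_[p]) (j : ℕ),
      oneCocycleClass (discreteTopRep (towerSubgroup κ K₀ n) (W.geomPrimaryTorsion p)) ψ = c ∧
        p ^ (j + 1) • Q₁ = p ^ j • g ∧
        ∀ τ : localSubgroupOfEmb (towerSubgroup κ K₀ n) ι,
          pointsMapOfEmb W ι ((ψ.1 (resGalSubgroupOfEmb (towerSubgroup κ K₀ n) ι τ) :
              W.geomPrimaryTorsion p) : W.geomPoints) =
            (τ : Field.absoluteGaloisGroup ℚ_[p]) • Q₁ - Q₁) :
    c ∉ localKummerOverOfEmb W p (towerSubgroup κ K₀ n) ι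
      (towerSignedLocalPointsOfEmb (towerSubgroup κ K₀) ι W (-1) n) := by
  obtain ⟨M, hE, hEt, htr, hVM⟩ := exists_padicModel_tr_eq_zero V hgood hap
  haveI := hE; haveI := hEt
  exact not_mem_localKummerOverOfEmb_neg_one_of_kummer_generator_towerSubgroup K₀ ι W hp2 hκ hz
    (by rw [RelModel.index_galRange (K := K) K₀]; exact hK₀) M htr (hVM.trans hWV.symm) n hg hτ₀ hndiv hcg

end Tower

end Summit.BirchSwinnertonDyer.Rank1Residual.Additive

end
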